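import Literature.AlgebraicGeometry.Motives.AbelianVarietyQuaternionBrauerRelations
import HarnessLib

/-!
# The Brauer relation lattice of the generalised quaternion group `Q₁₆` in full: `K(Q₁₆) = Inf K(D_4)` — rank `3`,
# generated by the lifts from `Q₁₆/Z ≅ D_4` of `D_4`'s three generators; no relation involves the trivial subgroup,
# `Prim(Q₁₆) = 0`

Layer A1/A2 of the Hodge foundations lane (`lit-hodgefound`, row A1-20⁺ · A2, seat p03 generation 28, row g28-#6) on
the ALGEBRAIC carrier; sequel of `Motives/AbelianVarietyQuaternionBrauerRelations` (g28-#4: `K(Q₈) = ℤ·Θ_inf`, and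
the mechanism `apply_eq_zero_of_sum_smul_indClassFun_eq_zero_of_mem_center` with its `Q₁₆` instance
`zpowers_a_four_le_of_ne_bot_quaternionGroup_four` — CONSUMED) and of `Motives/AbelianVarietyDihedralOrderEightBrauerRelations`
(g28-#2: `K(D_4) = ℤΘ_dih ⊕ ℤΘ_inf ⊕ ℤΘ_ind` — the lattice being lifted here; CONSUMED: the marks dictionary).
Bartel–Dokchitser, proof of Theorem 4: "If `P` is cyclic or generalised quaternion, then every non-trivial subgroup
contains `C_p`, so `P` has no primitive relations" — i.e. every relation of `Q_{2^{n+2}}` is lifted from the dihedral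
quotient `Q_{2^{n+2}}/Z`.  Here, for `n = 2`, on Mathlib's `QuaternionGroup 4` (`Q₁₆ = ⟨c, x | c⁸ = 1, c⁴ = x², x⁻¹cx = c⁻¹⟩`,
`c = a 1`, `x = xa 0`, `Z = ⟨c⁴⟩ = ⟨a 4⟩`): the NINE classes of subgroups
`1, Z, ⟨c²⟩, ⟨c⟩, ⟨x⟩, ⟨cx⟩, Q = ⟨x, c²⟩ ≅ Q₈, Q' = ⟨cx, c²⟩ ≅ Q₈, Q₁₆`, all nine permutation characters as explicit
functions (§2), the six class equations solved (§3): **`a ∈ K(Q₁₆)` iff `a_1 = 0`, `a_Z = −a_{c²} − a_c`,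
`a_x = a_c − a_Q`, `a_{cx} = a_c + 2a_{c²} + a_Q`, `a_{Q'} = −2a_{c²} − a_Q`, `a_G = −2a_c`** — which is EXACTLY the
lattice `K(D_4)` of g28-#2 transported along `H ↦ H/Z` (`Z ↦ 1`, `⟨c²⟩ ↦ Z(D_4)`, `⟨c⟩ ↦ ⟨σ⟩`, `⟨x⟩ ↦ ⟨τ⟩`,
`⟨cx⟩ ↦ ⟨στ⟩`, `Q ↦ K_τ`, `Q' ↦ K_{στ}`) together with `a_1 = 0`; hence (§4) **`rank K(Q₁₆) = 3`** with basis the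
three LIFTS **`⟨x⟩ − ⟨cx⟩ − Q + Q'`** (of `Θ_dih`), **`⟨c²⟩ − ⟨c⟩ − Q − Q' + 2G`** (of `Θ_inf`, i.e. of `C_2 × C_2`'s
relation through `Q₁₆/⟨c²⟩`), **`Z − ⟨c²⟩ − 2⟨x⟩ + 2Q`** (of `Θ_ind`): `K(Q₁₆) = Inf K(D_4)`, all of it imprimitive.
Everything here is PROVED; NO definition, NO named fact (net Literature debt 0).

## Sources, verbatim

A. Bartel, T. Dokchitser, *Brauer relations in finite groups*, J. Eur. Math. Soc. **17** (2015) (arXiv 1103.2047, held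
`paper:arxiv-1103.2047`).  §5 Proposition 4 (p0010): "Let `P` be a `p`-group with normal `p`-rank one. Then `P` is
one of the following: the cyclic group […]; the dihedral group […]; the generalised quaternions,
`Q_{2^{n+2}} = ⟨c, x | c^{2^n} = x², x⁻¹cx = c⁻¹⟩` with `n ≥ 1`; the semi-dihedral group […]"; proof of Theorem 4
(p0010): "Now suppose that `r = 1`, so `P` is as in Proposition 4. If `P` is cyclic or generalised quaternion, then
every non-trivial subgroup contains `C_p`, so `P` has no primitive relations by Corollary 3.5."; Theorem 4 (p0010):
"All Brauer relations in `p`-groups are `ℤ`-linear combinations of ones lifted from subquotients `P` of the following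
types: (1) `P ≅ C_p × C_p` […]; (3) `P ≅ D_{2^n}`, and the relation is `I − IZ − J + JZ` […]"; §2 (p0006): "Inflation.
If `G ≅ G̃/N`, then each `H_i` corresponds to a subgroup `H̃_i` of `G̃` containing `N`, and […] `Θ̃ = Σ_i n_i H̃_i` is a
`G̃`-relation."; "the rank of `K(G)` is the number of conjugacy classes of non-cyclic subgroups".

## Dictionary and what is proved (namespace `Literature.AlgebraicGeometry.Motives.AbelianVariety`)

`Q₁₆ = QuaternionGroup 4` (`a m`, `xa m`, `m ∈ ℤ/8`); representatives (indices `0…8`)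
`![⊥, zpowers (a 4), zpowers (a 2), zpowers (a 1), zpowers (xa 0), zpowers (xa 1), zpowers (xa 0) ⊔ zpowers (a 2),
zpowers (xa 1) ⊔ zpowers (a 2), ⊤] = ![1, Z, ⟨c²⟩, ⟨c⟩, ⟨x⟩, ⟨cx⟩, Q, Q', G]`; classes described by `g = 1 ∨ g = a 4`,
`∃ k, g = a (2k)`, `∃ k, g = a k`, `∃ k, g = xa (2k)`, `∃ k, g = xa (2k+1)`.

* §1 `quaternionGroup_four_cases`, `quaternionGroup_four_orderOf_a_four/_a_two`, `mem_quaternionEight_iff`,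
  `mem_quaternionEight'_iff` (`g ∈ Q ↔ g = x^a c^{2b}`), `center_quaternionGroup_four` (`Z(Q₁₆) = ⟨c⁴⟩`).
* §2 `card_conj_mem_*_quaternionFour` (seven marks functions), `natCard_subgroups_quaternionFour`,
  **`indClassFun_one_apply_quaternionFour`**.
* §3 `sum_smul_indClassFun_quaternionFour_apply`, **`sum_smul_indClassFun_quaternionFour_eq_zero_iff`**,
  `infDih/infKlein/infInd_mem_quaternionFour`.
* §4 `mem_brauerRelations_quaternionFour_iff`, **`apply_bot_eq_zero_of_mem_brauerRelations_quaternionFour`**,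
  **`eq_combination_of_mem_brauerRelations_quaternionFour`**, **`brauerRelations_quaternionFour_eq_span`**
  (`K(Q₁₆) = Inf K(D_4)`), `linearIndependent_basis_quaternionFour`, `ker_linearCombination_indClassFun_one_quaternionFour_eq_span`,
  **`finrank_ker_linearCombination_indClassFun_one_quaternionFour`** (`= 3`),
  **`mem_brauerRelations_quaternionFour_iff_dihedralFour`** (the coordinate conditions ARE `D_4`'s plus `a_1 = 0`).

Scope (stated, not hidden): only `Q₁₆` (`n = 2` of `Q_{2^{n+2}}`; `Q₈` is g28-#4); the identification of the support
with the subgroup lattice of `Q₁₆/Z ≅ D_4` is by the explicit dictionary above (coordinates), the marks-level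
inflation functor being `Motives/AbelianVarietyBrauerRelationInflation`; no Kani–Rosen isogeny is restated (the
tree's `isIsogenous_dicyclic` family in `Motives/AbelianVarietyRelativePartitionIdempotentRelations` covers `Q_{4n}`).

## References

* [BartelDokchitser2015] A. Bartel, T. Dokchitser, *Brauer relations in finite groups*, JEMS 17 (2015), §2, §5
  Proposition 4, Theorem 4 and its proof.
* [LangeRodriguez2022] H. Lange, R. E. Rodríguez, *Decomposition of Jacobians by Prym varieties*, LNM 2310, §5.3
  (the `D_4` lattice being lifted), §7.2.
-/

noncomputable section

universe u

open CategoryTheory CategoryTheory.Limits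
open Literature.RepresentationTheory.FiniteGroups

namespace Literature.AlgebraicGeometry.Motives

namespace AbelianVariety

-- scoped INSIDE the namespace: the constructor `a` must not leak into appended audit code
open QuaternionGroup

/-! ## §1 `Q₁₆ = QuaternionGroup 4`: classes, orders, the two quaternion subgroups of index `2`, the centre -/

section QuaternionFourGroup

/-- `|Q₁₆| = 16`. [cite: BartelDokchitser2015, §5 Proposition 4 ("Q_{2^{n+2}}")] -/
theorem card_quaternionGroup_four : Fintype.card (QuaternionGroup 4) = 16 := by
  rw [QuaternionGroup.card]

/-- **The seven conjugacy classes of `Q₁₆`**: `{1}`, `{c⁴}`, `{c², c⁶}`, `{c^{±1}}`, `{c^{±3}}`, `{x c^{even}}`,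
`{x c^{odd}}` — every element is one of `a 0, …, a 7, xa 0, …, xa 7`. [cite: BartelDokchitser2015, §5 Proposition 4] -/
theorem quaternionGroup_four_cases (g : QuaternionGroup 4) :
    g = 1 ∨ g = a 4 ∨ (g = a 2 ∨ g = a 6) ∨ (g = a 1 ∨ g = a 3 ∨ g = a 5 ∨ g = a 7) ∨
      (g = xa 0 ∨ g = xa 2 ∨ g = xa 4 ∨ g = xa 6) ∨ (g = xa 1 ∨ g = xa 3 ∨ g = xa 5 ∨ g = xa 7) := by
  revert g
  decide

/-- `c⁴ = a 4` has order `2`. [cite: BartelDokchitser2015, §5 Proposition 4 ("c^{2^n} = x²"), proof of Theorem 4 ("contains C_p")] -/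
theorem quaternionGroup_four_orderOf_a_four : orderOf (a 4 : QuaternionGroup 4) = 2 := by
  rw [orderOf_eq_prime_iff (p := 2)]
  decide

/-- `c² = a 2` has order `4`. [cite: BartelDokchitser2015, §5 Proposition 4 ("c^{2^n} = x²")] -/
theorem quaternionGroup_four_orderOf_a_two : orderOf (a 2 : QuaternionGroup 4) = 4 := by
  rw [orderOf_eq_iff (by norm_num)]
  decide

/-- `c = a 1` has order `8 = 2·4`. [cite: BartelDokchitser2015, §5 Proposition 4 ("c^{2^n} = x²", "x² … order 4")] -/
theorem quaternionGroup_four_orderOf_a_one : orderOf (a 1 : QuaternionGroup 4) = 2 * 4 := orderOf_a_one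

/-- `g ∈ ⟨a 4⟩ ↔ g ∈ {(a 4)^k : k < 2}`. [folklore] -/
private theorem mem_zpowers_a_four_iff (g : QuaternionGroup 4) :
    g ∈ Subgroup.zpowers (a 4 : QuaternionGroup 4) ↔ g ∈ (Finset.range 2).image ((a 4 : QuaternionGroup 4) ^ ·) := by
  rw [mem_zpowers_iff_mem_range_orderOf, quaternionGroup_four_orderOf_a_four]

/-- `g ∈ ⟨a 2⟩ ↔ g ∈ {(a 2)^k : k < 4}`. [folklore] -/
private theorem mem_zpowers_a_two_iff' (g : QuaternionGroup 4) :
    g ∈ Subgroup.zpowers (a 2 : QuaternionGroup 4) ↔ g ∈ (Finset.range 4).image ((a 2 : QuaternionGroup 4) ^ ·) := by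
  rw [mem_zpowers_iff_mem_range_orderOf, quaternionGroup_four_orderOf_a_two]

/-- `g ∈ ⟨a 1⟩ ↔ g ∈ {(a 1)^k : k < 8}`. [folklore] -/
private theorem mem_zpowers_a_one_iff' (g : QuaternionGroup 4) :
    g ∈ Subgroup.zpowers (a 1 : QuaternionGroup 4) ↔ g ∈ (Finset.range (2 * 4)).image ((a 1 : QuaternionGroup 4) ^ ·) := by
  rw [mem_zpowers_iff_mem_range_orderOf, quaternionGroup_four_orderOf_a_one]

/-- `g ∈ ⟨xa m⟩ ↔ g ∈ {(xa m)^k : k < 4}`. [folklore] -/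
private theorem mem_zpowers_xa_iff' (m : ZMod (2 * 4)) (g : QuaternionGroup 4) :
    g ∈ Subgroup.zpowers (xa m : QuaternionGroup 4) ↔ g ∈ (Finset.range 4).image ((xa m : QuaternionGroup 4) ^ ·) := by
  rw [mem_zpowers_iff_mem_range_orderOf, orderOf_xa]

/-- `⟨c²⟩ ⊴ Q₁₆`. [folklore] -/
private theorem normal_zpowers_a_two_quaternionGroup_four : (Subgroup.zpowers (a 2 : QuaternionGroup 4)).Normal := by
  refine ⟨fun n hn g ↦ ?_⟩
  rw [mem_zpowers_a_two_iff'] at hn ⊢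
  revert hn
  revert n g
  decide

/-- **`g ∈ Q = ⟨x⟩ ⊔ ⟨c²⟩` (a quaternion subgroup of index `2`) ↔ `g = x^a c^{2b}`, `a < 4`, `b < 4`.**
[cite: BartelDokchitser2015, §5 proof of Theorem 4 ("every non-trivial subgroup contains C_p")] -/
theorem mem_quaternionEight_iff (g : QuaternionGroup 4) :
    g ∈ (Subgroup.zpowers (xa 0 : QuaternionGroup 4) ⊔ Subgroup.zpowers (a 2 : QuaternionGroup 4)) ↔
      ∃ h ∈ (Finset.range 4).image ((xa 0 : QuaternionGroup 4) ^ ·),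
        ∃ n ∈ (Finset.range 4).image ((a 2 : QuaternionGroup 4) ^ ·), h * n = g := by
  haveI := normal_zpowers_a_two_quaternionGroup_four
  rw [Subgroup.mem_sup_of_normal_right]
  simp only [mem_zpowers_xa_iff', mem_zpowers_a_two_iff']

/-- **`g ∈ Q' = ⟨cx⟩ ⊔ ⟨c²⟩ ↔ g = (xa 1)^a c^{2b}`.** [cite: BartelDokchitser2015, §5 proof of Theorem 4] -/
theorem mem_quaternionEight'_iff (g : QuaternionGroup 4) :
    g ∈ (Subgroup.zpowers (xa 1 : QuaternionGroup 4) ⊔ Subgroup.zpowers (a 2 : QuaternionGroup 4)) ↔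
      ∃ h ∈ (Finset.range 4).image ((xa 1 : QuaternionGroup 4) ^ ·),
        ∃ n ∈ (Finset.range 4).image ((a 2 : QuaternionGroup 4) ^ ·), h * n = g := by
  haveI := normal_zpowers_a_two_quaternionGroup_four
  rw [Subgroup.mem_sup_of_normal_right]
  simp only [mem_zpowers_xa_iff', mem_zpowers_a_two_iff']

/-- **`Z(Q₁₆) = ⟨c⁴⟩ = ⟨a 4⟩`.** [cite: BartelDokchitser2015, §5 Theorem 4 (3) ("Z = Z(P)") and proof ("contains C_p")] -/
theorem center_quaternionGroup_four : Subgroup.center (QuaternionGroup 4) = Subgroup.zpowers (a 4) := by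
  ext g
  rw [Subgroup.mem_center_iff, mem_zpowers_a_four_iff]
  revert g
  decide

end QuaternionFourGroup

/-! ## §2 The marks and permutation characters of the nine representatives, machine-checked -/

section QuaternionFourMarks

/-- `|{x : Q x}|` as a filter cardinality. [folklore] -/
private theorem natCard_subtype_eq_card_filter_q16 (P : QuaternionGroup 4 → Prop) [DecidablePred P]
    (Q : QuaternionGroup 4 → Prop) (hQP : ∀ x, Q x ↔ P x) :
    Nat.card {x : QuaternionGroup 4 // Q x} = (Finset.univ.filter P).card := by
  rw [← Fintype.card_subtype, ← Nat.card_eq_fintype_card]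
  exact Nat.card_congr (Equiv.subtypeEquivRight hQP)

/-- Marks of `Z, ⟨c²⟩, ⟨c⟩, ⟨x⟩, ⟨cx⟩`, machine-checked. [folklore] -/
private theorem marks_table_cyclic_q16 (g : QuaternionGroup 4) :
    ((Finset.univ.filter fun x : QuaternionGroup 4 ↦
        x⁻¹ * g * x ∈ (Finset.range 2).image ((a 4 : QuaternionGroup 4) ^ ·)).card =
      (if g = 1 ∨ g = a 4 then 16 else 0)) ∧
    ((Finset.univ.filter fun x : QuaternionGroup 4 ↦
        x⁻¹ * g * x ∈ (Finset.range 4).image ((a 2 : QuaternionGroup 4) ^ ·)).card =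
      (if ∃ k : ZMod 8, g = a (2 * k) then 16 else 0)) ∧
    ((Finset.univ.filter fun x : QuaternionGroup 4 ↦
        x⁻¹ * g * x ∈ (Finset.range (2 * 4)).image ((a 1 : QuaternionGroup 4) ^ ·)).card =
      (if ∃ k : ZMod 8, g = a k then 16 else 0)) ∧
    ((Finset.univ.filter fun x : QuaternionGroup 4 ↦
        x⁻¹ * g * x ∈ (Finset.range 4).image ((xa 0 : QuaternionGroup 4) ^ ·)).card =
      (if g = 1 ∨ g = a 4 then 16 else if ∃ k : ZMod 8, g = xa (2 * k) then 8 else 0)) ∧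
    ((Finset.univ.filter fun x : QuaternionGroup 4 ↦
        x⁻¹ * g * x ∈ (Finset.range 4).image ((xa 1 : QuaternionGroup 4) ^ ·)).card =
      (if g = 1 ∨ g = a 4 then 16 else if ∃ k : ZMod 8, g = xa (2 * k + 1) then 8 else 0)) := by
  revert g
  decide

/-- **Marks of `Z = ⟨c⁴⟩`**: `16·[g ∈ Z]`. [cite: BartelDokchitser2015, §5 proof of Theorem 4 ("C_p")] -/
theorem card_conj_mem_center_quaternionFour (g : QuaternionGroup 4) :
    Nat.card {x : QuaternionGroup 4 // x⁻¹ * g * x ∈ Subgroup.zpowers (a 4 : QuaternionGroup 4)} =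
      if g = 1 ∨ g = a 4 then 16 else 0 := by
  classical
  rw [natCard_subtype_eq_card_filter_q16 _ _ fun x ↦ mem_zpowers_a_four_iff _]
  exact (marks_table_cyclic_q16 g).1

/-- **Marks of `⟨c²⟩`**: `16·[g ∈ ⟨c²⟩]`. [cite: BartelDokchitser2015, §1.1 ("Θ ∈ K(G) ⟺ Σ_i n_i Ind 1_{H_i} = 0"); §5 Proposition 4] -/
theorem card_conj_mem_zpowers_a_two_quaternionFour (g : QuaternionGroup 4) :
    Nat.card {x : QuaternionGroup 4 // x⁻¹ * g * x ∈ Subgroup.zpowers (a 2 : QuaternionGroup 4)} =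
      if ∃ k : ZMod 8, g = a (2 * k) then 16 else 0 := by
  classical
  rw [natCard_subtype_eq_card_filter_q16 _ _ fun x ↦ mem_zpowers_a_two_iff' _]
  exact (marks_table_cyclic_q16 g).2.1

/-- **Marks of `⟨c⟩`**: `16·[g ∈ ⟨c⟩]`. [cite: BartelDokchitser2015, §1.1; §5 Proposition 4] -/
theorem card_conj_mem_zpowers_a_one_quaternionFour (g : QuaternionGroup 4) :
    Nat.card {x : QuaternionGroup 4 // x⁻¹ * g * x ∈ Subgroup.zpowers (a 1 : QuaternionGroup 4)} =
      if ∃ k : ZMod 8, g = a k then 16 else 0 := by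
  classical
  rw [natCard_subtype_eq_card_filter_q16 _ _ fun x ↦ mem_zpowers_a_one_iff' _]
  exact (marks_table_cyclic_q16 g).2.2.1

/-- **Marks of `⟨x⟩ = ⟨xa 0⟩`**: `16` on `Z`, `8` on the class `{x c^{even}}`. [cite: BartelDokchitser2015, §1.1; §5 Proposition 4] -/
theorem card_conj_mem_zpowers_xa_zero_quaternionFour (g : QuaternionGroup 4) :
    Nat.card {x : QuaternionGroup 4 // x⁻¹ * g * x ∈ Subgroup.zpowers (xa 0 : QuaternionGroup 4)} =
      if g = 1 ∨ g = a 4 then 16 else if ∃ k : ZMod 8, g = xa (2 * k) then 8 else 0 := by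
  classical
  rw [natCard_subtype_eq_card_filter_q16 _ _ fun x ↦ mem_zpowers_xa_iff' 0 _]
  exact (marks_table_cyclic_q16 g).2.2.2.1

/-- **Marks of `⟨cx⟩ = ⟨xa 1⟩`**: `16` on `Z`, `8` on `{x c^{odd}}`. [cite: BartelDokchitser2015, §1.1; §5 Proposition 4] -/
theorem card_conj_mem_zpowers_xa_one_quaternionFour (g : QuaternionGroup 4) :
    Nat.card {x : QuaternionGroup 4 // x⁻¹ * g * x ∈ Subgroup.zpowers (xa 1 : QuaternionGroup 4)} =
      if g = 1 ∨ g = a 4 then 16 else if ∃ k : ZMod 8, g = xa (2 * k + 1) then 8 else 0 := by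
  classical
  rw [natCard_subtype_eq_card_filter_q16 _ _ fun x ↦ mem_zpowers_xa_iff' 1 _]
  exact (marks_table_cyclic_q16 g).2.2.2.2

/-- **Marks of `Q = ⟨x, c²⟩ ⊴ Q₁₆`**: `16·[g ∈ Q]`, machine-checked. [cite: BartelDokchitser2015, §5 proof of Theorem 4] -/
theorem card_conj_mem_quaternionEight_quaternionFour (g : QuaternionGroup 4) :
    Nat.card {x : QuaternionGroup 4 // x⁻¹ * g * x ∈
        (Subgroup.zpowers (xa 0 : QuaternionGroup 4) ⊔ Subgroup.zpowers (a 2 : QuaternionGroup 4))} =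
      if (∃ k : ZMod 8, g = a (2 * k)) ∨ ∃ k : ZMod 8, g = xa (2 * k) then 16 else 0 := by
  classical
  rw [natCard_subtype_eq_card_filter_q16 _ _ fun x ↦ mem_quaternionEight_iff _]
  revert g
  decide

/-- **Marks of `Q' = ⟨cx, c²⟩ ⊴ Q₁₆`**: `16·[g ∈ Q']`. [cite: BartelDokchitser2015, §5 proof of Theorem 4] -/
theorem card_conj_mem_quaternionEight'_quaternionFour (g : QuaternionGroup 4) :
    Nat.card {x : QuaternionGroup 4 // x⁻¹ * g * x ∈
        (Subgroup.zpowers (xa 1 : QuaternionGroup 4) ⊔ Subgroup.zpowers (a 2 : QuaternionGroup 4))} =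
      if (∃ k : ZMod 8, g = a (2 * k)) ∨ ∃ k : ZMod 8, g = xa (2 * k + 1) then 16 else 0 := by
  classical
  rw [natCard_subtype_eq_card_filter_q16 _ _ fun x ↦ mem_quaternionEight'_iff _]
  revert g
  decide

/-- The orders `2, 4, 8, 4, 4, 8, 8` of `Z, ⟨c²⟩, ⟨c⟩, ⟨x⟩, ⟨cx⟩, Q, Q'`. [cite: BartelDokchitser2015, §5 Proposition 4 ("Q_{2^{n+2}} = ⟨c, x | c^{2^n} = x², x⁻¹cx = c⁻¹⟩")] -/
theorem natCard_subgroups_quaternionFour :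
    Nat.card (Subgroup.zpowers (a 4 : QuaternionGroup 4)) = 2 ∧ Nat.card (Subgroup.zpowers (a 2 : QuaternionGroup 4)) = 4 ∧
    Nat.card (Subgroup.zpowers (a 1 : QuaternionGroup 4)) = 8 ∧ Nat.card (Subgroup.zpowers (xa 0 : QuaternionGroup 4)) = 4 ∧
    Nat.card (Subgroup.zpowers (xa 1 : QuaternionGroup 4)) = 4 ∧
    Nat.card ↥(Subgroup.zpowers (xa 0 : QuaternionGroup 4) ⊔ Subgroup.zpowers (a 2 : QuaternionGroup 4)) = 8 ∧
    Nat.card ↥(Subgroup.zpowers (xa 1 : QuaternionGroup 4) ⊔ Subgroup.zpowers (a 2 : QuaternionGroup 4)) = 8 := by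
  classical
  refine ⟨?_, ?_, ?_, ?_, ?_, ?_, ?_⟩
  · rw [Nat.card_zpowers, quaternionGroup_four_orderOf_a_four]
  · rw [Nat.card_zpowers, quaternionGroup_four_orderOf_a_two]
  · rw [Nat.card_zpowers, quaternionGroup_four_orderOf_a_one]
  · rw [Nat.card_zpowers, orderOf_xa]
  · rw [Nat.card_zpowers, orderOf_xa]
  · exact (natCard_subtype_eq_card_filter_q16 _ _ mem_quaternionEight_iff).trans (by decide)
  · exact (natCard_subtype_eq_card_filter_q16 _ _ mem_quaternionEight'_iff).trans (by decide)

/-- **The permutation characters of the nine representatives, as explicit functions on `Q₁₆`.**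
[cite: BartelDokchitser2015, §1.1 ("Θ ∈ K(G) ⟺ Σ_i n_i Ind 1_{H_i} = 0")] -/
theorem indClassFun_one_apply_quaternionFour (g : QuaternionGroup 4) :
    indClassFun (⊥ : Subgroup (QuaternionGroup 4)) 1 g = (if g = 1 then 16 else 0) ∧
    indClassFun (Subgroup.zpowers (a 4 : QuaternionGroup 4)) 1 g = (if g = 1 ∨ g = a 4 then 8 else 0) ∧
    indClassFun (Subgroup.zpowers (a 2 : QuaternionGroup 4)) 1 g = (if ∃ k : ZMod 8, g = a (2 * k) then 4 else 0) ∧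
    indClassFun (Subgroup.zpowers (a 1 : QuaternionGroup 4)) 1 g = (if ∃ k : ZMod 8, g = a k then 2 else 0) ∧
    indClassFun (Subgroup.zpowers (xa 0 : QuaternionGroup 4)) 1 g =
      (if g = 1 ∨ g = a 4 then 4 else if ∃ k : ZMod 8, g = xa (2 * k) then 2 else 0) ∧
    indClassFun (Subgroup.zpowers (xa 1 : QuaternionGroup 4)) 1 g =
      (if g = 1 ∨ g = a 4 then 4 else if ∃ k : ZMod 8, g = xa (2 * k + 1) then 2 else 0) ∧
    indClassFun (Subgroup.zpowers (xa 0 : QuaternionGroup 4) ⊔ Subgroup.zpowers (a 2 : QuaternionGroup 4)) 1 g =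
      (if (∃ k : ZMod 8, g = a (2 * k)) ∨ ∃ k : ZMod 8, g = xa (2 * k) then 2 else 0) ∧
    indClassFun (Subgroup.zpowers (xa 1 : QuaternionGroup 4) ⊔ Subgroup.zpowers (a 2 : QuaternionGroup 4)) 1 g =
      (if (∃ k : ZMod 8, g = a (2 * k)) ∨ ∃ k : ZMod 8, g = xa (2 * k + 1) then 2 else 0) ∧
    indClassFun (⊤ : Subgroup (QuaternionGroup 4)) 1 g = 1 := by
  classical
  obtain ⟨c1, c2, c3, c4, c5, c6, c7⟩ := natCard_subgroups_quaternionFour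
  refine ⟨?_, ?_, ?_, ?_, ?_, ?_, ?_, ?_, ?_⟩
  · rw [indClassFun_one_apply_eq_div, card_conj_mem_bot, Subgroup.card_bot, card_quaternionGroup_four]
    split_ifs <;> norm_num
  · rw [indClassFun_one_apply_eq_div, card_conj_mem_center_quaternionFour, c1]
    split_ifs <;> norm_num
  · rw [indClassFun_one_apply_eq_div, card_conj_mem_zpowers_a_two_quaternionFour, c2]
    split_ifs <;> norm_num
  · rw [indClassFun_one_apply_eq_div, card_conj_mem_zpowers_a_one_quaternionFour, c3]
    split_ifs <;> norm_num
  · rw [indClassFun_one_apply_eq_div, card_conj_mem_zpowers_xa_zero_quaternionFour, c4]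
    split_ifs <;> norm_num
  · rw [indClassFun_one_apply_eq_div, card_conj_mem_zpowers_xa_one_quaternionFour, c5]
    split_ifs <;> norm_num
  · rw [indClassFun_one_apply_eq_div, card_conj_mem_quaternionEight_quaternionFour, c6]
    split_ifs <;> norm_num
  · rw [indClassFun_one_apply_eq_div, card_conj_mem_quaternionEight'_quaternionFour, c7]
    split_ifs <;> norm_num
  · rw [indClassFun_top_one, Pi.one_apply]

end QuaternionFourMarks

/-! ## §3 The six class equations; the three lifted relations -/

section QuaternionFourRelations

/-- A nine-term sum of scalar multiples of functions, evaluated at a point. [folklore] -/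
private theorem sum_fin_nine_smul_apply (a : Fin 9 → ℤ) (F : Fin 9 → QuaternionGroup 4 → ℂ) (g : QuaternionGroup 4) :
    (∑ i : Fin 9, (a i : ℂ) • F i) g = a 0 * F 0 g + a 1 * F 1 g + a 2 * F 2 g + a 3 * F 3 g + a 4 * F 4 g +
      a 5 * F 5 g + a 6 * F 6 g + a 7 * F 7 g + a 8 * F 8 g := by
  simp [Finset.sum_apply, Fin.sum_univ_succ]
  ring

/-- The signed-sum test on the nine representatives `![1, Z, ⟨c²⟩, ⟨c⟩, ⟨x⟩, ⟨cx⟩, Q, Q', G]`, pointwise.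
[cite: BartelDokchitser2015, §1.1 ("Θ ∈ K(G) ⟺ Σ_i n_i Ind 1_{H_i} = 0")] -/
theorem sum_smul_indClassFun_quaternionFour_apply (a : Fin 9 → ℤ) (g : QuaternionGroup 4) :
    (∑ i : Fin 9, (a i : ℂ) • indClassFun ((![⊥, Subgroup.zpowers (QuaternionGroup.a 4 : QuaternionGroup 4),
        Subgroup.zpowers (QuaternionGroup.a 2 : QuaternionGroup 4), Subgroup.zpowers (QuaternionGroup.a 1 : QuaternionGroup 4),
        Subgroup.zpowers (xa 0 : QuaternionGroup 4), Subgroup.zpowers (xa 1 : QuaternionGroup 4),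
        Subgroup.zpowers (xa 0 : QuaternionGroup 4) ⊔ Subgroup.zpowers (QuaternionGroup.a 2 : QuaternionGroup 4),
        Subgroup.zpowers (xa 1 : QuaternionGroup 4) ⊔ Subgroup.zpowers (QuaternionGroup.a 2 : QuaternionGroup 4), ⊤] :
        Fin 9 → Subgroup (QuaternionGroup 4)) i) 1) g =
      a 0 * (if g = 1 then 16 else 0) + a 1 * (if g = 1 ∨ g = QuaternionGroup.a 4 then 8 else 0) +
        a 2 * (if ∃ k : ZMod 8, g = QuaternionGroup.a (2 * k) then 4 else 0) +
        a 3 * (if ∃ k : ZMod 8, g = QuaternionGroup.a k then 2 else 0) +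
        a 4 * (if g = 1 ∨ g = QuaternionGroup.a 4 then 4 else if ∃ k : ZMod 8, g = xa (2 * k) then 2 else 0) +
        a 5 * (if g = 1 ∨ g = QuaternionGroup.a 4 then 4 else if ∃ k : ZMod 8, g = xa (2 * k + 1) then 2 else 0) +
        a 6 * (if (∃ k : ZMod 8, g = QuaternionGroup.a (2 * k)) ∨ ∃ k : ZMod 8, g = xa (2 * k) then 2 else 0) +
        a 7 * (if (∃ k : ZMod 8, g = QuaternionGroup.a (2 * k)) ∨ ∃ k : ZMod 8, g = xa (2 * k + 1) then 2 else 0) +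
        a 8 := by
  obtain ⟨h0, h1, h2, h3, h4, h5, h6, h7, h8⟩ := indClassFun_one_apply_quaternionFour g
  rw [sum_fin_nine_smul_apply]
  show (a 0 : ℂ) * indClassFun (⊥ : Subgroup (QuaternionGroup 4)) 1 g +
      (a 1 : ℂ) * indClassFun (Subgroup.zpowers (QuaternionGroup.a 4 : QuaternionGroup 4)) 1 g +
      (a 2 : ℂ) * indClassFun (Subgroup.zpowers (QuaternionGroup.a 2 : QuaternionGroup 4)) 1 g +
      (a 3 : ℂ) * indClassFun (Subgroup.zpowers (QuaternionGroup.a 1 : QuaternionGroup 4)) 1 g +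
      (a 4 : ℂ) * indClassFun (Subgroup.zpowers (xa 0 : QuaternionGroup 4)) 1 g +
      (a 5 : ℂ) * indClassFun (Subgroup.zpowers (xa 1 : QuaternionGroup 4)) 1 g +
      (a 6 : ℂ) * indClassFun (Subgroup.zpowers (xa 0 : QuaternionGroup 4) ⊔
        Subgroup.zpowers (QuaternionGroup.a 2 : QuaternionGroup 4)) 1 g +
      (a 7 : ℂ) * indClassFun (Subgroup.zpowers (xa 1 : QuaternionGroup 4) ⊔
        Subgroup.zpowers (QuaternionGroup.a 2 : QuaternionGroup 4)) 1 g +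
      (a 8 : ℂ) * indClassFun (⊤ : Subgroup (QuaternionGroup 4)) 1 g = _
  rw [h0, h1, h2, h3, h4, h5, h6, h7, h8, mul_one]

/-- **The Brauer relations of `Q₁₆` are exactly the integer vectors `a` on `![1, Z, ⟨c²⟩, ⟨c⟩, ⟨x⟩, ⟨cx⟩, Q, Q', G]`
with `a_1 = 0`, `a_Z = −a_{c²} − a_c`, `a_x = a_c − a_Q`, `a_{cx} = a_c + 2a_{c²} + a_Q`, `a_{Q'} = −2a_{c²} − a_Q`,
`a_G = −2a_c`** (free parameters `a_{c²}, a_c, a_Q`: rank `3` = the classes of non-cyclic subgroups `Q, Q', Q₁₆`) —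
the six class equations at `1, c⁴, c², c, x, cx` solved. [cite: BartelDokchitser2015, §1.1; §2 ("rank … non-cyclic subgroups"); §5 proof of Theorem 4] -/
theorem sum_smul_indClassFun_quaternionFour_eq_zero_iff (a : Fin 9 → ℤ) :
    ∑ i : Fin 9, (a i : ℂ) • indClassFun ((![⊥, Subgroup.zpowers (QuaternionGroup.a 4 : QuaternionGroup 4),
        Subgroup.zpowers (QuaternionGroup.a 2 : QuaternionGroup 4), Subgroup.zpowers (QuaternionGroup.a 1 : QuaternionGroup 4),
        Subgroup.zpowers (xa 0 : QuaternionGroup 4), Subgroup.zpowers (xa 1 : QuaternionGroup 4),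
        Subgroup.zpowers (xa 0 : QuaternionGroup 4) ⊔ Subgroup.zpowers (QuaternionGroup.a 2 : QuaternionGroup 4),
        Subgroup.zpowers (xa 1 : QuaternionGroup 4) ⊔ Subgroup.zpowers (QuaternionGroup.a 2 : QuaternionGroup 4), ⊤] :
        Fin 9 → Subgroup (QuaternionGroup 4)) i) 1 = 0 ↔
      a 0 = 0 ∧ a 1 = -a 2 - a 3 ∧ a 4 = a 3 - a 6 ∧ a 5 = a 3 + 2 * a 2 + a 6 ∧ a 7 = -2 * a 2 - a 6 ∧ a 8 = -2 * a 3 := by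
  constructor
  · intro h
    have e := fun g ↦ (sum_smul_indClassFun_quaternionFour_apply a g).symm.trans (congr_fun h g)
    have e1 := e 1
    have e2 := e (QuaternionGroup.a 4)
    have e3 := e (QuaternionGroup.a 2)
    have e4 := e (QuaternionGroup.a 1)
    have e5 := e (xa 0)
    have e6 := e (xa 1)
    simp (config := { decide := true }) only [Pi.zero_apply, if_true, if_false, mul_zero, add_zero] at e1 e2 e3 e4 e5 e6
    have i1 : ((16 * a 0 + 8 * a 1 + 4 * a 2 + 2 * a 3 + 4 * a 4 + 4 * a 5 + 2 * a 6 + 2 * a 7 + a 8 : ℤ) : ℂ) = 0 := by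
      push_cast; linear_combination e1
    have i2 : ((8 * a 1 + 4 * a 2 + 2 * a 3 + 4 * a 4 + 4 * a 5 + 2 * a 6 + 2 * a 7 + a 8 : ℤ) : ℂ) = 0 := by
      push_cast; linear_combination e2
    have i3 : ((4 * a 2 + 2 * a 3 + 2 * a 6 + 2 * a 7 + a 8 : ℤ) : ℂ) = 0 := by push_cast; linear_combination e3
    have i4 : ((2 * a 3 + a 8 : ℤ) : ℂ) = 0 := by push_cast; linear_combination e4
    have i5 : ((2 * a 4 + 2 * a 6 + a 8 : ℤ) : ℂ) = 0 := by push_cast; linear_combination e5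
    have i6 : ((2 * a 5 + 2 * a 7 + a 8 : ℤ) : ℂ) = 0 := by push_cast; linear_combination e6
    norm_cast at i1 i2 i3 i4 i5 i6
    omega
  · rintro ⟨h0, h1, h4, h5, h7, h8⟩
    funext g
    rw [sum_smul_indClassFun_quaternionFour_apply, Pi.zero_apply, h0, h1, h4, h5, h7, h8]
    push_cast
    rcases quaternionGroup_four_cases g with rfl | rfl | (rfl | rfl) | (rfl | rfl | rfl | rfl) |
        (rfl | rfl | rfl | rfl) | (rfl | rfl | rfl | rfl) <;>
    · simp (config := { decide := true }) only [if_true, if_false]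
      ring

/-- **`⟨x⟩ − ⟨cx⟩ − Q + Q'`, the LIFT from `Q₁₆/Z ≅ D_4` of `D_4`'s dihedral relation `⟨τ⟩ − ⟨στ⟩ − K_τ + K_{στ}`,
is a relation of `Q₁₆`.** [cite: BartelDokchitser2015, §2 (Inflation); §5 Theorem 4 (3)] -/
theorem infDih_mem_quaternionFour :
    ∑ i : Fin 9, (((![0, 0, 0, 0, 1, -1, -1, 1, 0] : Fin 9 → ℤ) i : ℤ) : ℂ) • indClassFun ((![⊥, Subgroup.zpowers (QuaternionGroup.a 4 : QuaternionGroup 4),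
        Subgroup.zpowers (QuaternionGroup.a 2 : QuaternionGroup 4), Subgroup.zpowers (QuaternionGroup.a 1 : QuaternionGroup 4),
        Subgroup.zpowers (xa 0 : QuaternionGroup 4), Subgroup.zpowers (xa 1 : QuaternionGroup 4),
        Subgroup.zpowers (xa 0 : QuaternionGroup 4) ⊔ Subgroup.zpowers (QuaternionGroup.a 2 : QuaternionGroup 4),
        Subgroup.zpowers (xa 1 : QuaternionGroup 4) ⊔ Subgroup.zpowers (QuaternionGroup.a 2 : QuaternionGroup 4), ⊤] :
        Fin 9 → Subgroup (QuaternionGroup 4)) i) 1 = 0 :=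
  (sum_smul_indClassFun_quaternionFour_eq_zero_iff _).2 (by simp)

/-- **`⟨c²⟩ − ⟨c⟩ − Q − Q' + 2G`, the lift from `Q₁₆/⟨c²⟩ ≅ C_2 × C_2` of `1 − Σ_C C + 2·(C_2 × C_2)`** (= the lift of
`D_4`'s `Θ_inf`), is a relation. [cite: BartelDokchitser2015, §2 (Inflation; Example 3); §5 Theorem 4 (1)] -/
theorem infKlein_mem_quaternionFour :
    ∑ i : Fin 9, (((![0, 0, 1, -1, 0, 0, -1, -1, 2] : Fin 9 → ℤ) i : ℤ) : ℂ) • indClassFun ((![⊥, Subgroup.zpowers (QuaternionGroup.a 4 : QuaternionGroup 4),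
        Subgroup.zpowers (QuaternionGroup.a 2 : QuaternionGroup 4), Subgroup.zpowers (QuaternionGroup.a 1 : QuaternionGroup 4),
        Subgroup.zpowers (xa 0 : QuaternionGroup 4), Subgroup.zpowers (xa 1 : QuaternionGroup 4),
        Subgroup.zpowers (xa 0 : QuaternionGroup 4) ⊔ Subgroup.zpowers (QuaternionGroup.a 2 : QuaternionGroup 4),
        Subgroup.zpowers (xa 1 : QuaternionGroup 4) ⊔ Subgroup.zpowers (QuaternionGroup.a 2 : QuaternionGroup 4), ⊤] :
        Fin 9 → Subgroup (QuaternionGroup 4)) i) 1 = 0 :=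
  (sum_smul_indClassFun_quaternionFour_eq_zero_iff _).2 (by simp)

/-- **`Z − ⟨c²⟩ − 2⟨x⟩ + 2Q`, the lift from `Q₁₆/Z ≅ D_4` of `D_4`'s induced relation `Θ_ind = 1 − Z − 2⟨τ⟩ + 2K_τ`**,
is a relation. [cite: BartelDokchitser2015, §2 (Inflation, Induction); §5 Theorem 4 (1)] -/
theorem infInd_mem_quaternionFour :
    ∑ i : Fin 9, (((![0, 1, -1, 0, -2, 0, 2, 0, 0] : Fin 9 → ℤ) i : ℤ) : ℂ) • indClassFun ((![⊥, Subgroup.zpowers (QuaternionGroup.a 4 : QuaternionGroup 4),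
        Subgroup.zpowers (QuaternionGroup.a 2 : QuaternionGroup 4), Subgroup.zpowers (QuaternionGroup.a 1 : QuaternionGroup 4),
        Subgroup.zpowers (xa 0 : QuaternionGroup 4), Subgroup.zpowers (xa 1 : QuaternionGroup 4),
        Subgroup.zpowers (xa 0 : QuaternionGroup 4) ⊔ Subgroup.zpowers (QuaternionGroup.a 2 : QuaternionGroup 4),
        Subgroup.zpowers (xa 1 : QuaternionGroup 4) ⊔ Subgroup.zpowers (QuaternionGroup.a 2 : QuaternionGroup 4), ⊤] :
        Fin 9 → Subgroup (QuaternionGroup 4)) i) 1 = 0 :=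
  (sum_smul_indClassFun_quaternionFour_eq_zero_iff _).2 (by simp)

end QuaternionFourRelations

/-! ## §4 `K(Q₁₆) = Inf K(D_4)`: rank `3`, no relation involves `1` -/

section QuaternionFourLattice

variable (𝒦 : Submodule ℤ (Fin 9 → ℤ))
  (h𝒦 : ∀ a : Fin 9 → ℤ, a ∈ 𝒦 ↔ ∑ i : Fin 9, (a i : ℂ) • indClassFun ((![⊥, Subgroup.zpowers (QuaternionGroup.a 4 : QuaternionGroup 4),
        Subgroup.zpowers (QuaternionGroup.a 2 : QuaternionGroup 4), Subgroup.zpowers (QuaternionGroup.a 1 : QuaternionGroup 4),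
        Subgroup.zpowers (xa 0 : QuaternionGroup 4), Subgroup.zpowers (xa 1 : QuaternionGroup 4),
        Subgroup.zpowers (xa 0 : QuaternionGroup 4) ⊔ Subgroup.zpowers (QuaternionGroup.a 2 : QuaternionGroup 4),
        Subgroup.zpowers (xa 1 : QuaternionGroup 4) ⊔ Subgroup.zpowers (QuaternionGroup.a 2 : QuaternionGroup 4), ⊤] :
        Fin 9 → Subgroup (QuaternionGroup 4)) i) 1 = 0)
include h𝒦

/-- **Membership in `K(Q₁₆)` in coordinates.** [cite: BartelDokchitser2015, §1.1; §5 proof of Theorem 4] -/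
theorem mem_brauerRelations_quaternionFour_iff (a : Fin 9 → ℤ) :
    a ∈ 𝒦 ↔ a 0 = 0 ∧ a 1 = -a 2 - a 3 ∧ a 4 = a 3 - a 6 ∧ a 5 = a 3 + 2 * a 2 + a 6 ∧ a 7 = -2 * a 2 - a 6 ∧ a 8 = -2 * a 3 :=
  (h𝒦 a).trans (sum_smul_indClassFun_quaternionFour_eq_zero_iff a)

/-- **The coordinate conditions of `K(Q₁₆)` are `a_1 = 0` together with EXACTLY the conditions of `K(D_4)`**
(g28-#2's `sum_smul_indClassFun_dihedralFour_eq_zero_iff`, in the coordinates `b` of `D_4 = Q₁₆/Z` transported along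
`b_1 = a_Z`, `b_Z = a_{c²}`, `b_τ = a_x`, `b_{στ} = a_{cx}`, `b_σ = a_c`, `b_{K_τ} = a_Q`, `b_{K_{στ}} = a_{Q'}`, `b_G = a_G`):
`K(Q₁₆) = Inf K(D_4)`. [cite: BartelDokchitser2015, §2 (Inflation); §5 proof of Theorem 4 ("every non-trivial subgroup contains C_p, so P has no primitive relations")] -/
theorem mem_brauerRelations_quaternionFour_iff_dihedralFour (a : Fin 9 → ℤ) :
    a ∈ 𝒦 ↔ a 0 = 0 ∧
      (fun b : Fin 8 → ℤ ↦ b 0 = -b 1 - b 4 ∧ b 2 = b 4 - b 5 ∧ b 3 = 2 * b 1 + b 5 + b 4 ∧ b 6 = -2 * b 1 - b 5 ∧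
        b 7 = -2 * b 4) ![a 1, a 2, a 4, a 5, a 3, a 6, a 7, a 8] := by
  rw [mem_brauerRelations_quaternionFour_iff 𝒦 h𝒦]
  simp only [Matrix.cons_val_zero, Matrix.cons_val_one, Matrix.cons_val]
  omega

/-- **No relation of `Q₁₆` involves the trivial subgroup** (`a_1 = 0`; also g28-#4's
`apply_eq_zero_of_relation_quaternionGroup_four` for arbitrary families). [cite: BartelDokchitser2015, §5 proof of Theorem 4] -/
theorem apply_bot_eq_zero_of_mem_brauerRelations_quaternionFour {a : Fin 9 → ℤ} (ha : a ∈ 𝒦) : a 0 = 0 :=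
  ((mem_brauerRelations_quaternionFour_iff 𝒦 h𝒦 a).1 ha).1

/-- The three lifts are in `K(Q₁₆)`. [cite: BartelDokchitser2015, §2 (Inflation); §5 Theorem 4] -/
theorem inf_mem_brauerRelations_quaternionFour :
    (![0, 0, 0, 0, 1, -1, -1, 1, 0] : Fin 9 → ℤ) ∈ 𝒦 ∧ (![0, 0, 1, -1, 0, 0, -1, -1, 2] : Fin 9 → ℤ) ∈ 𝒦 ∧ (![0, 1, -1, 0, -2, 0, 2, 0, 0] : Fin 9 → ℤ) ∈ 𝒦 :=
  ⟨(h𝒦 _).2 infDih_mem_quaternionFour, (h𝒦 _).2 infKlein_mem_quaternionFour, (h𝒦 _).2 infInd_mem_quaternionFour⟩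

/-- **Every relation of `Q₁₆` is an explicit combination of the three lifts.** [cite: BartelDokchitser2015, §5 Theorem 4 and its proof] -/
theorem eq_combination_of_mem_brauerRelations_quaternionFour {a : Fin 9 → ℤ} (ha : a ∈ 𝒦) :
    a = (-2 * a 2 - a 3 - a 6) • (![0, 0, 0, 0, 1, -1, -1, 1, 0] : Fin 9 → ℤ) + (-a 3) • (![0, 0, 1, -1, 0, 0, -1, -1, 2] : Fin 9 → ℤ) +
      (-a 2 - a 3) • (![0, 1, -1, 0, -2, 0, 2, 0, 0] : Fin 9 → ℤ) := by
  obtain ⟨h0, h1, h4, h5, h7, h8⟩ := (mem_brauerRelations_quaternionFour_iff 𝒦 h𝒦 a).1 ha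
  funext i
  fin_cases i <;> simp <;> omega

/-- **`K(Q₁₆) = ℤ·Inf Θ_dih ⊕ ℤ·Inf Θ_inf ⊕ ℤ·Inf Θ_ind = Inf K(D_4)`.** [cite: BartelDokchitser2015, §5 Theorem 4 and its proof; §2 (Inflation)] -/
theorem brauerRelations_quaternionFour_eq_span :
    𝒦 = Submodule.span ℤ {(![0, 0, 0, 0, 1, -1, -1, 1, 0] : Fin 9 → ℤ), ![0, 0, 1, -1, 0, 0, -1, -1, 2], ![0, 1, -1, 0, -2, 0, 2, 0, 0]} := by
  obtain ⟨m1, m2, m3⟩ := inf_mem_brauerRelations_quaternionFour 𝒦 h𝒦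
  refine le_antisymm (fun a ha ↦ ?_) (Submodule.span_le.2 ?_)
  · rw [eq_combination_of_mem_brauerRelations_quaternionFour 𝒦 h𝒦 ha]
    refine Submodule.add_mem _ (Submodule.add_mem _ (Submodule.smul_mem _ _ (Submodule.subset_span (by simp)))
      (Submodule.smul_mem _ _ (Submodule.subset_span (by simp)))) (Submodule.smul_mem _ _ (Submodule.subset_span (by simp)))
  · rintro v (rfl | rfl | rfl)
    exacts [m1, m2, m3]

omit h𝒦 in
/-- The three lifts are linearly independent (coordinates `Z`, `G`, `⟨x⟩`). [cite: BartelDokchitser2015, §2 ("clearly linearly independent")] -/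
theorem linearIndependent_basis_quaternionFour :
    LinearIndependent ℤ (![(![0, 0, 0, 0, 1, -1, -1, 1, 0] : Fin 9 → ℤ), ![0, 0, 1, -1, 0, 0, -1, -1, 2], ![0, 1, -1, 0, -2, 0, 2, 0, 0]] : Fin 3 → Fin 9 → ℤ) := by
  rw [Fintype.linearIndependent_iff]
  intro c hc i
  have e1 := congr_fun hc 1
  have e8 := congr_fun hc 8
  have e4 := congr_fun hc 4
  simp [Fin.sum_univ_three] at e1 e8 e4
  fin_cases i <;> simp <;> omega

omit h𝒦 in
/-- The canonical lattice `K(Q₁₆) = ker(a ↦ Σ_i a_i (1_{H_i})^G)` is the span of the three lifts.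
[cite: BartelDokchitser2015, §5 Theorem 4] -/
theorem ker_linearCombination_indClassFun_one_quaternionFour_eq_span :
    LinearMap.ker (Fintype.linearCombination ℤ fun i : Fin 9 ↦ indClassFun ((![⊥, Subgroup.zpowers (QuaternionGroup.a 4 : QuaternionGroup 4),
        Subgroup.zpowers (QuaternionGroup.a 2 : QuaternionGroup 4), Subgroup.zpowers (QuaternionGroup.a 1 : QuaternionGroup 4),
        Subgroup.zpowers (xa 0 : QuaternionGroup 4), Subgroup.zpowers (xa 1 : QuaternionGroup 4),
        Subgroup.zpowers (xa 0 : QuaternionGroup 4) ⊔ Subgroup.zpowers (QuaternionGroup.a 2 : QuaternionGroup 4),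
        Subgroup.zpowers (xa 1 : QuaternionGroup 4) ⊔ Subgroup.zpowers (QuaternionGroup.a 2 : QuaternionGroup 4), ⊤] :
        Fin 9 → Subgroup (QuaternionGroup 4)) i) 1) =
      Submodule.span ℤ {(![0, 0, 0, 0, 1, -1, -1, 1, 0] : Fin 9 → ℤ), ![0, 0, 1, -1, 0, 0, -1, -1, 2], ![0, 1, -1, 0, -2, 0, 2, 0, 0]} :=
  brauerRelations_quaternionFour_eq_span _ (mem_ker_linearCombination_indClassFun_one_iff _)

omit h𝒦 in
/-- **`rank K(Q₁₆) = 3`** (on the canonical lattice) — the number of conjugacy classes of non-cyclic subgroups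
(`Q, Q', Q₁₆`), equal to `rank K(D_4)`. [cite: BartelDokchitser2015, §2; §5 proof of Theorem 4] -/
theorem finrank_ker_linearCombination_indClassFun_one_quaternionFour :
    Module.finrank ℤ (LinearMap.ker (Fintype.linearCombination ℤ fun i : Fin 9 ↦ indClassFun ((![⊥, Subgroup.zpowers (QuaternionGroup.a 4 : QuaternionGroup 4),
        Subgroup.zpowers (QuaternionGroup.a 2 : QuaternionGroup 4), Subgroup.zpowers (QuaternionGroup.a 1 : QuaternionGroup 4),
        Subgroup.zpowers (xa 0 : QuaternionGroup 4), Subgroup.zpowers (xa 1 : QuaternionGroup 4),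
        Subgroup.zpowers (xa 0 : QuaternionGroup 4) ⊔ Subgroup.zpowers (QuaternionGroup.a 2 : QuaternionGroup 4),
        Subgroup.zpowers (xa 1 : QuaternionGroup 4) ⊔ Subgroup.zpowers (QuaternionGroup.a 2 : QuaternionGroup 4), ⊤] :
        Fin 9 → Subgroup (QuaternionGroup 4)) i) 1)) = 3 := by
  rw [ker_linearCombination_indClassFun_one_quaternionFour_eq_span]
  have h := linearIndependent_basis_quaternionFour
  rw [show ({(![0, 0, 0, 0, 1, -1, -1, 1, 0] : Fin 9 → ℤ), ![0, 0, 1, -1, 0, 0, -1, -1, 2], ![0, 1, -1, 0, -2, 0, 2, 0, 0]} : Set (Fin 9 → ℤ)) =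
      Set.range (![(![0, 0, 0, 0, 1, -1, -1, 1, 0] : Fin 9 → ℤ), ![0, 0, 1, -1, 0, 0, -1, -1, 2], ![0, 1, -1, 0, -2, 0, 2, 0, 0]] : Fin 3 → Fin 9 → ℤ) by
    ext v
    simp only [Set.mem_insert_iff, Set.mem_singleton_iff, Set.mem_range]
    constructor
    · rintro (rfl | rfl | rfl)
      exacts [⟨0, rfl⟩, ⟨1, rfl⟩, ⟨2, rfl⟩]
    · rintro ⟨i, rfl⟩
      fin_cases i <;> simp]
  rw [finrank_span_eq_card h, Fintype.card_fin]

end QuaternionFourLattice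

end AbelianVariety

end Literature.AlgebraicGeometry.Motives
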